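import Mathlib
import Literature.Algebra.Polynomial.NewtonPolytope
import Literature.Barriers.PneNP.TSPExtensionComplexity
import Literature.Computability.AlgebraicComplexity.CircuitDepth
import HarnessLib

/-!
# Hrubeš–Yehudayoff 2021, Theorem 35: monotone formulas have Newton polytopes of linear extension
# complexity

Topic `Literature/Computability/AlgebraicComplexity`. Source: P. Hrubeš, A. Yehudayoff, *Shadows of Newton polytopes*,
CCC 2021, LIPIcs 200:9, §5.4 "Lower bounds from extension complexity" (held text `paper:url-d136d073b26d` p0014 L23–31,
read this session): "▶ Lemma 34. For polytopes `P, Q ⊆ ℝⁿ` we have `xc(P + Q) ≤ xc(P) + xc(Q)` and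
`xc(P ⊔ Q) ≤ xc(P) + xc(Q) + 2`. … The lower bound is now proved by a straightforward induction. ▶ Theorem 35. Assume that
`f` has a monotone formula of size `s`. Then `xc(Newt(f)) ≤ O(s)`." (§1.2, p0004 L34–36: "if `f` has monotone formula of
size `s` then `xc(Newt(f)) ≤ O(s)`"; Remark 36: with Rothvoss' `xc(MATCH_n) = 2^{Ω(n)}` this gives monotone formula lower
bounds for the Pfaffian.)

Typed over the tree's vocabulary — monotone formulas = fan-in-two formulas of the straight-line model over `ℝ≥0`
(`ArithCircuit ℝ≥0 (Fin n)`, `IsFormula`, `IsFanInTwo`, `Computes`, `size`: `ArithCircuit.lean`, `CircuitDepth.lean`), Newton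
polytope `Literature.Algebra.Polynomial.NewtonPolytope.newtonPolytope` of the real lift `map NNReal.toRealHom f` (as in
`NewtonPolygonTauMonotone`), extension complexity via `Literature.Barriers.PneNP.HasEFOfSize` (`TSPExtensionComplexity.lean`;
"`xc(P) ≤ r`" is `HasEFOfSize P r`, upward closed by `HasEFOfSize.of_le`) — and `O(s)` as an absolute constant `C` with the
bound `C·(s+1)`.  Named fact (theorem in print; the proof is Lemma 34 = Balas' union bound plus `Newt(f+g) = conv(Newt f ∪ Newt g)`,
`Newt(fg) = Newt f + Newt g` for monotone `f, g`, by induction on the formula) — NOT proved here: no `_holds`.  Honest framing: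
a Literature fact; nothing here bears on `VP ≠ VNP` (NOT proved). [cite: HrubesYehudayoff2021, Theorem 35]
-/

noncomputable section

namespace Literature.Computability.AlgebraicComplexity.HrubesYehudayoff

open scoped NNReal
open Literature.Algebra.Polynomial.NewtonPolytope Literature.Barriers.PneNP

/-- **Hrubeš–Yehudayoff 2021, Theorem 35** (printed: "Assume that `f` has a monotone formula of size `s`. Then
`xc(Newt(f)) ≤ O(s)`."): there is an absolute constant `C` such that for every `n` and every polynomial `f` over `ℝ≥0` in `n`
variables computed by a monotone fan-in-two formula with at most `s` gates, the Newton polytope of `f` (in `ℝⁿ`) has an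
extended formulation of size `C·(s+1)`. [cite: HrubesYehudayoff2021, Theorem 35 (§5.4, with Lemma 34)] -/
def theorem35 : Prop :=
  ∃ C : ℕ, ∀ (n s : ℕ) (f : MvPolynomial (Fin n) ℝ≥0) (P : ArithCircuit ℝ≥0 (Fin n)),
    P.IsFormula → P.IsFanInTwo → P.Computes f → P.size ≤ s →
      HasEFOfSize (newtonPolytope (MvPolynomial.map NNReal.toRealHom f)) (C * (s + 1))

end Literature.Computability.AlgebraicComplexity.HrubesYehudayoff

end
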